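/-
COR-CM (cell pub-hodgecm2, stage 2 of the Hodge ladder) — lane V-TRANSPORT (seat b06 gen 22; count-neutral, no BINDER-OWNERS row,
no E term, no display of record; Interfaces (C1) untouched; wording of record untouched).  THE ORBIT NORMAL FORM of the junction-B01
ideation memo IDEA-1g (b01-idea-1 gen 7, «one tower per field», `HOME/b01/IDEA-1g-Sketch.lean` §6/§9 `periodNV_orbit`), now
UNCONDITIONAL on the universe of record: its four rows are tree theorems — A = `Model.periodNV_transport` (TowerTransport, b06),
B = `Model.periodNV_relabel` (TowerRelabel, b06), C = `Model.periodNV_of_periodNV_of_forall_mem` (PeriodCharacterTransport, b07 g35),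
T = `Model.periodNV_face_twist` (CMTwistSemilinear, idea-1 g7 / filed b06).  CREDIT for the statement and architecture: b01-idea-1 g7.
Wording of record (verbatim, unchanged by this file): HC_CM follows in the kernel from BallQuotientUniformised ∧ PerLFace(model universe of record).
T5: consistency check by b06 g22 2026-08-21T18:22Z — BY INHABITATION: the only named-fact hypothesis binders of the new theorems are the four universe-of-record records `exists_isReal_hodgeModel` / `hodgePQ_independent_of_hodgeModel` / `BallQuotientUniformised` (resp. `BallQuotientUniformisedDatum`) / `CMAbelianVarietyRealised`, all DISCHARGED tree theorems (`exists_isReal_hodgeModel_holds`, `hodgePQ_independent_of_hodgeModel_holds`, `BallQuotient.ballQuotientUniformised_holds` / `ballQuotientUniformisedDatum_of`, `cmAbelianVarietyRealised_holds`), so their conjunction is inhabited and no contradiction is derivable; the remaining binders are data and elementary side conditions (`2 < finrank ℚ L`, `IsGalois ℚ F`, `finrank ℚ F = 6`, a `PeriodNV`/`PerL` ANTECEDENT of the same open kind as the conclusion — transports, no supply hypothesis, no hand-summarised Literature binder) — no contradiction derived.  HC_CM is NOT proved.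
-/
import Summits.HodgeConjecture.CorCM.CMTwistSemilinear
import Summits.HodgeConjecture.CorCM.TowerRelabel
import Summits.HodgeConjecture.CorCM.PeriodCharacterTransport
import HarnessLib

/-!
# COR-CM — one non-zero face period per `Aut F`-orbit: the orbit normal form of `PeriodNV` on the universe of record

On `U = Model.picardCMUniverse hHD hI h₁ h₃` and for a CM field `F` with `[F:ℚ] > 2` (every face field has `[F:ℚ] ≥ 6`):

* **`Model.periodNV_orbit`** — ONE non-zero face period `PeriodNV ι₁ V F f.psi ι₁` (one admissible `ι₁`, one hermitian space `V`)
  gives `PeriodNV (ι₁ ∘ h⁻¹) V₂ F (f.twist g).psi τ` for ALL `g, h ∈ Aut F`, every `τ` admissible for the twisted face `g · f`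
  and EVERY hermitian space `V₂` over `ι₁ ∘ h⁻¹`: twist on the same surface (T), move the eigencharacter (C), relabel the tower
  and spread over all hermitian spaces (B, which contains A);
* `Model.periodNV_orbit_sameTower` — the same on the `ι₁`-tower (`h = 1`): all `V₂ : HermSpace3 F ι₁` (T, C, A).

So the displayed junction target `PeriodThmF(U) = PerLFace(U)` is met over `F` as soon as ONE non-zero face period is produced
per `Aut F`-orbit of (twisted) faces and tower places — for `F` Galois of degree `6`, where `Gal(F/ℚ) ≅ C₆` acts transitively on
the six type squares (IDEA-1g memo §0 Δ5; b07 `FaceSquareSymmetry`), ONE face period per field.  This file creates no period and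
changes no row; it is by-name planning input for the owner of junction B01.  Theorems only.
-/

noncomputable section

open NumberField
open Literature.AlgebraicGeometry.Motives (CMType)
open Literature.AlgebraicGeometry.HodgeTheory
open Literature.NumberTheory.Automorphic.PicardCM

namespace Summit.HodgeConjecture.CorCM

namespace Model

variable (hHD : exists_isReal_hodgeModel) (hI : hodgePQ_independent_of_hodgeModel)
  (h₁ : BallQuotientUniformised) (h₃ : CMAbelianVarietyRealised)

/-- **THE ORBIT NORMAL FORM on the universe of record (IDEA-1g, unconditional).**  For `[F:ℚ] > 2`, a face `f`, an admissible
`ι₁`, ONE hermitian space `V` with `PeriodNV ι₁ V F f.psi ι₁`, and any `g h ∈ Aut F`, any `τ` admissible for `f.twist g`, any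
`V₂ : HermSpace3 F (ι₁ ∘ h⁻¹)`: `PeriodNV (ι₁ ∘ h⁻¹) V₂ F (f.twist g).psi τ`.  Rows: T (`periodNV_face_twist`), C
(`periodNV_of_periodNV_of_forall_mem`, b07), B (`periodNV_relabel`, which spreads over all `V₂` by row A). [folklore] -/
theorem periodNV_orbit {F : CMField} (hF : 2 < Module.finrank ℚ F) (f : Face F) {ι₁ : F →+* ℂ} (hι : f.Admissible ι₁)
    {V : HermSpace3 F ι₁} (h : (picardCMUniverse hHD hI h₁ h₃).PeriodNV ι₁ V F f.psi ι₁) (g h' : F ≃+* F) (τ : F →+* ℂ)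
    (hτ : (f.twist g).Admissible τ) (V₂ : HermSpace3 F (ι₁.comp h'.symm.toRingHom)) :
    (picardCMUniverse hHD hI h₁ h₃).PeriodNV (ι₁.comp h'.symm.toRingHom) V₂ F (f.twist g).psi τ := by
  -- T: twist the targets and the character on the same surface
  have hT := periodNV_face_twist hHD hI h₁ h₃ f hι g h
  -- C: move the eigencharacter from `ι₁ ∘ g⁻¹` to `τ` (both lie in all four twisted period types)
  have hC : (picardCMUniverse hHD hI h₁ h₃).PeriodNV ι₁ V F (f.twist g).psi τ :=
    periodNV_of_periodNV_of_forall_mem hHD hI h₁ h₃ V (f.twist g).psi (admissible_mem_psi (f.twist g) τ hτ) hT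
  -- B (⊇ A): relabel the tower along `h'` and spread over every hermitian space
  exact periodNV_relabel hHD hI h₁ h₃ hF h' V₂ hC

/-- **The orbit normal form on the `ι₁`-tower** (`h = 1`): from ONE `V` to every `V₂ : HermSpace3 F ι₁`, every twist `g` and every
admissible `τ` (rows T, C, A). [folklore] -/
theorem periodNV_orbit_sameTower {F : CMField} (hF : 2 < Module.finrank ℚ F) (f : Face F) {ι₁ : F →+* ℂ}
    (hι : f.Admissible ι₁) {V : HermSpace3 F ι₁} (h : (picardCMUniverse hHD hI h₁ h₃).PeriodNV ι₁ V F f.psi ι₁)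
    (g : F ≃+* F) (τ : F →+* ℂ) (hτ : (f.twist g).Admissible τ) (V₂ : HermSpace3 F ι₁) :
    (picardCMUniverse hHD hI h₁ h₃).PeriodNV ι₁ V₂ F (f.twist g).psi τ := by
  have hT := periodNV_face_twist hHD hI h₁ h₃ f hι g h
  have hC : (picardCMUniverse hHD hI h₁ h₃).PeriodNV ι₁ V F (f.twist g).psi τ :=
    periodNV_of_periodNV_of_forall_mem hHD hI h₁ h₃ V (f.twist g).psi (admissible_mem_psi (f.twist g) τ hτ) hT
  exact periodNV_transport hHD hI h₁ h₃ hF V₂ hC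

/-- **Untwisted special case** (`g = 1` in substance): from ONE `V` and the admissible `ι₁` to every admissible `τ` and every `V₂`
on the `ι₁`-tower — rows C and A only. [folklore] -/
theorem periodNV_of_periodNV {F : CMField} (hF : 2 < Module.finrank ℚ F) (f : Face F) {ι₁ : F →+* ℂ}
    {V : HermSpace3 F ι₁} (h : (picardCMUniverse hHD hI h₁ h₃).PeriodNV ι₁ V F f.psi ι₁)
    (τ : F →+* ℂ) (hτ : f.Admissible τ) (V₂ : HermSpace3 F ι₁) :
    (picardCMUniverse hHD hI h₁ h₃).PeriodNV ι₁ V₂ F f.psi τ :=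
  periodNV_transport hHD hI h₁ h₃ hF V₂
    (periodNV_of_periodNV_of_forall_mem hHD hI h₁ h₃ V f.psi (admissible_mem_psi f τ hτ) h)

end Model

end Summit.HodgeConjecture.CorCM

end
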